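import Summits.CriticalPhenomena.PercolationContinuityZ3.Theorems.Transplant.KNStarScheme
import HarnessLib

/-!
# v3′ — the ENTRY-SEED STAR scheme (generic layer, part 2): the replayed state, success, validity and the scheme as an `HSiteScheme`
# (design of record: HOME/ENTRY-SEED-STAR.md + HOME/prim-bschramm-p2-g2/KIT3-SIGNATURE.md)

builds on p205010 (kernel theorem, internal audit signed; external expert review pending) — nothing in this file uses p205010.
Lane `prim-bschramm`, seat `prim-bschramm-p2` (generic v3′); helper file (`--supports stmt-CriticalPhenomena-4575`).

* `supd` (update of the replayed state by an examination), **`sstOf`** (replay of a history), `succ`, `mst_eq_sstOf` (the `HSiteScheme` replay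
  of the macro-state is the macro part of `sstOf`);
* **`Valid₃`** (the envelope is fresh; the direction was onward at the source's examination; the source's pinned strip vertices lie in their
  strips and are joined to the source's entry vertex by the source's star pattern, which consists of recorded open edges; the root is joined to
  the source's entry vertex by recorded open edges), `nextProbe₃`, **`scheme₃`**, `nextProbe₃_eq_some`, `nextProbe₃_of_valid`.
[cite: KozmaNitzan2024, §4 pp. 25–27 (exploration processes; (1)–(5))] [cite: GrimmettPercolation1999, §7.2]
-/

noncomputable section

open MeasureTheory ProbabilityTheory
open scoped ENNReal Classical

namespace Summit.CriticalPhenomena.PercolationContinuityZ3.Theorems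

namespace Transplant

namespace KNStar

open Literature.Probability.Percolation Literature.Probability.LatticeModels SimpleGraph GadgetSystem ProbeHistory HSiteScheme
open KNCells (vspan mem_vspan_iff)
open Literature.Probability.Percolation.KozmaNitzan (opens)

variable {V : Type*} [DecidableEq V]

namespace KSch₃

variable {A : Type*} (G : SimpleGraph V) [G.LocallyFinite] (S : KSch₃ V A)

/-! ## §4 Replay, validity and the scheme -/

/-- The update of the replayed state by a successful examination along `e` reading `o` (first open entry edge `i`). [folklore] -/
def supd (σ : SState V A) (h : ProbeHistory V) (e : Site 2 × MDir) (o : Finset (Sym2 V)) : SState V A :=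
  match S.entryIdx σ e o with
  | none => ⟨σ.st.update e False, σ.anc, σ.src, σ.pat, σ.ons⟩
  | some i =>
    ⟨σ.st.update e (S.succ₃ G σ h e o),
      Function.update σ.anc (tgt e) (S.candA σ e i),
      Function.update σ.src (tgt e) (S.candU σ e i),
      Function.update σ.pat (tgt e) o,
      Function.update σ.ons (tgt e) (S.onward₃ G h (tgt e))⟩

/-- **Replay** of a history (newest entry first): a recorded probe is the examination along the chosen edge of the state replayed from
the older part. [cite: KozmaNitzan2024, §4 pp. 25–27] -/
def sstOf : ProbeHistory V → SState V A
  | [] => S.sInit G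
  | none :: h => sstOf h
  | some r :: h =>
    match (sstOf h).st.choice with
    | none => sstOf h
    | some e => S.supd G (sstOf h) h e r.2

/-- **Success** of the probe made after `h` along `e`, reading `o`. [cite: KozmaNitzan2024, §4 p. 27] -/
def succ (h : ProbeHistory V) (e : Site 2 × MDir) (o : Finset (Sym2 V)) : Prop := S.succ₃ G (S.sstOf G h) h e o

/-- Replay of the empty history. [folklore] -/
@[simp] theorem sstOf_nil : S.sstOf G [] = S.sInit G := rfl

/-- A `none` step does not change the replayed state. [folklore] -/
@[simp] theorem sstOf_cons_none (h : ProbeHistory V) : S.sstOf G (none :: h) = S.sstOf G h := rfl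

/-- A recorded probe updates along the chosen edge, if any. [folklore] -/
theorem sstOf_cons_some (r : ProbeRecord V) (h : ProbeHistory V) :
    S.sstOf G (some r :: h) = (match (S.sstOf G h).st.choice with
      | none => S.sstOf G h
      | some e => S.supd G (S.sstOf G h) h e r.2) := rfl

/-- The macro part of the update is the `HState` update by success. [folklore] -/
theorem supd_st (σ : SState V A) (h : ProbeHistory V) (e : Site 2 × MDir) (o : Finset (Sym2 V)) :
    (S.supd G σ h e o).st = σ.st.update e (S.succ₃ G σ h e o) := by
  unfold supd
  cases hi : S.entryIdx σ e o with
  | none =>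
    have : ¬S.succ₃ G σ h e o := by rintro ⟨i, hi', -⟩; rw [hi] at hi'; cases hi'
    simp only [HSiteScheme.HState.update, this, if_false]
  | some i => rfl

/-- **The macro-state replayed by the `HSiteScheme` machinery from `succ` is the macro part of the replay.** [folklore] -/
theorem mst_eq_sstOf : ∀ h : ProbeHistory V, HSiteScheme.mstOf (S.succ G) h = (S.sstOf G h).st
  | [] => rfl
  | none :: h => by rw [HSiteScheme.mstOf_cons_none, sstOf_cons_none]; exact mst_eq_sstOf h
  | some r :: h => by
    rw [HSiteScheme.mstOf_cons_some, mst_eq_sstOf h, sstOf_cons_some]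
    cases (S.sstOf G h).st.choice with
    | none => rfl
    | some e => rw [supd_st]; rfl

/-- **Validity** of a history for the examination along `e`: the envelope is fresh (disjoint from the explored edges), and the source's
pinned data hold — every pinned strip vertex lies in its strip and is joined to the source's entry vertex by the source's star pattern,
which consists of explored edges. [cite: KozmaNitzan2024, §4 p. 25 (2), p. 27] -/
structure Valid₃ (h : ProbeHistory V) (e : Site 2 × MDir) : Prop where
  /-- the envelope is fresh -/
  fresh : Disjoint (S.env₃ G (S.sstOf G h) h e) (S.F G h)
  /-- the direction was onward when the source was examined (its arrival slab and strips belong to the source's star) -/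
  ons_mem : e.2 ∈ (S.sstOf G h).ons e.1
  /-- the pinned strip vertices lie in their strips -/
  strip_mem : ∀ i, S.entryV (S.sstOf G h) e i ∈ S.Γ.strip ((S.sstOf G h).anc e.1) e.1 e.2 i
  /-- and are joined to the source's entry vertex by explored OPEN edges -/
  joined : ∀ i, PConn ((S.sstOf G h).pat e.1) ((S.sstOf G h).src e.1) (S.entryV (S.sstOf G h) e i)
  /-- the source's star pattern consists of explored open edges: it lies in the recorded open edges -/
  pat_sub : (S.sstOf G h).pat e.1 ⊆ S.U₀ G ∪ opens h
  /-- the root is joined to the source's entry vertex by explored open edges -/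
  root_joined : PConn (S.U₀ G ∪ opens h) S.Γ.root ((S.sstOf G h).src e.1)

/-- The next probe: examine the chosen candidate, but only after a valid history. [cite: KozmaNitzan2024, §4 p. 27] -/
def nextProbe₃ (h : ProbeHistory V) : Option (AProbe V) :=
  match (S.sstOf G h).st.choice with
  | none => none
  | some e => if S.Valid₃ G h e then some (S.probe₃ G (S.sstOf G h) h e) else none

/-- **The entry-seed star exploration process** as a history-driven site scheme. [cite: KozmaNitzan2024, §4 pp. 25–27] -/
def scheme₃ : HSiteScheme V := ⟨⟨S.nextProbe₃ G⟩, S.U₀ G, S.succ G⟩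

/-- The scheme's macro-state is the macro part of the replay. [folklore] -/
theorem scheme₃_mst (h : ProbeHistory V) : (S.scheme₃ G).mst h = (S.sstOf G h).st := S.mst_eq_sstOf G h

/-- If a probe is made, the history is valid for the chosen edge and the probe is the staged examination. [folklore] -/
theorem nextProbe₃_eq_some {h : ProbeHistory V} {P : AProbe V} (hP : S.nextProbe₃ G h = some P) :
    ∃ e, (S.sstOf G h).st.choice = some e ∧ S.Valid₃ G h e ∧ P = S.probe₃ G (S.sstOf G h) h e := by
  unfold nextProbe₃ at hP
  cases hc : (S.sstOf G h).st.choice with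
  | none => rw [hc] at hP; simp at hP
  | some e =>
    rw [hc] at hP
    simp only at hP
    split_ifs at hP with hV
    rw [Option.some.injEq] at hP
    exact ⟨e, rfl, hV, hP.symm⟩

/-- Conversely a valid history with a candidate is probed. [folklore] -/
theorem nextProbe₃_of_valid {h : ProbeHistory V} {e : Site 2 × MDir}
    (hc : (S.sstOf G h).st.choice = some e) (hV : S.Valid₃ G h e) :
    S.nextProbe₃ G h = some (S.probe₃ G (S.sstOf G h) h e) := by
  unfold nextProbe₃; rw [hc]; simp only; rw [if_pos hV]

end KSch₃

end KNStar

end Transplant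

end Summit.CriticalPhenomena.PercolationContinuityZ3.Theorems

end
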